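import Literature.Geometry.Lorentzian.KerrDerivativeDecayLocal
import Literature.Geometry.Lorentzian.KerrDecayHierarchyProofs
import HarnessLib

/-!
# DRSR Corollary 3.1, (31): removing the qualitative regularity clause of (D3′) with the
# Cauchy problem (`KerrSchild.waveCauchyProblem`)

(statement group **gr.S24**; namespace `Literature.Geometry.Lorentzian.Kerr`, glue in
`Literature.Geometry.Lorentzian`)

`KerrDerivativeDecayLocal.lean` reduces the gr.S24 named fact
`Literature.Geometry.Lorentzian.drsr_wave_derivative_decay_kerr` (DRSR arXiv:1402.7034, Cor. 3.1
(31)) to the hypothesis (H) = (D2) ∧ (D3′) ∧ (L3), where (D3′) is the a priori clause (D3) of the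
(30)-chain (`‖y‖|Ψ_τ| ≤ C₀`, `‖y‖‖DΨ_τ‖ ≤ C₀` along each leaf: the radiation field) **plus** a third,
purely qualitative clause: boundedness of the leaf Hessian `D²Ψ_τ` on the compact part
`S ∩ {‖y‖ ≤ R₁}` of the leaf, up to the future event horizon. For the class `IsAdmissibleKerrWave`
(smooth solutions on the *open* exterior `{r > r₊}`) this clause is not automatic; it is, as soon
as the solution is known to extend smoothly across `𝓗⁺` — which is what the Cauchy problem on
the horizon-penetrating chart gives (DRSR §4.1: the reduction to data on `Σ₀`, a slice crossing
`𝓗⁺`; in this library `IsAdmissibleKerrWave.exists_horizonRegular_extension` of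
`KerrDecayHierarchyProofs.lean`, proved from the named fact `KerrSchild.waveCauchyProblem`
(Bär–Ginoux–Pfäffle 2007, Thm. 3.2.11) and the exterior domain of dependence
`Kerr.vanish_of_data_ball` (Hawking–Ellis 1973, §4.3), itself proved).

* `Kerr.leafFun_fderiv_fderiv_bounded_of_waveCauchyProblem` (**proved**): assuming
  `KerrSchild.waveCauchyProblem`, for `|a| < M`, `R₁ > r₊`, an admissible `ψ`, `τ ≥ 0` and any
  radius `ρ`, the leaf Hessian `D²Ψ_τ` (`Ψ_τ = leafFun … ψ τ` along `Σ̃_τ(h♯_{R₁})`) is bounded on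
  `S ∩ {‖y‖ ≤ ρ}`: on `S` the leaf function agrees near every point with
  `G = Ψ̃ ∘ (y ↦ (τ + h♯(y), y))`, `Ψ̃` the horizon-regular extension, which is smooth on the larger
  open region `{r(0,·) > r₊/2}` containing the compact set `{‖y‖ ≤ ρ} ∩ {r(0,·) ≥ r₊}`.
* `Literature.Geometry.Lorentzian.drsr_wave_derivative_decay_kerr_of_localEnergy_decay_of_waveCauchyProblem`
  (**proved**): `KerrSchild.waveCauchyProblem → (H′) → drsr_wave_derivative_decay_kerr` with
  (H′) = (D2) ∧ (D3) ∧ (L3) — (D2), (D3) *verbatim* the second and third clauses of the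
  hypothesis (D) of the (30)-assembly (`KerrPointwiseDecayHierarchy.lean`), (L3) the local
  third-order energy decay of `KerrDerivativeDecayLocal.lean`. Thus, modulo the Cauchy problem,
  (31) costs exactly (30)'s deep input plus the local third-order decay (DRSR Cor. 3.1, second
  estimate, `N`-commuted once, with Thm. 3.2 (29) at `j = 3`).

## References

* M. Dafermos, I. Rodnianski, Y. Shlapentokh-Rothman, arXiv:1402.7034 = Ann. of Math. 183 (2016),
  §3.3 Cor. 3.1 (31), Thm. 3.2 (29), §4.1 (key `DafermosRodnianskiShlapentokhrothman2014`).
* C. Bär, N. Ginoux, F. Pfäffle, *Wave equations on Lorentzian manifolds and quantization*, EMS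
  2007, Thm. 3.2.11 (key `BarGinouxPfaffle2007`).
* S. W. Hawking, G. F. R. Ellis, *The large scale structure of space-time*, CUP 1973, §4.3
  (key `HawkingEllis1973CUP`).
-/

noncomputable section

open Set Filter MeasureTheory Metric TopologicalSpace Module
open scoped Topology ENNReal Manifold ContDiff

namespace Literature.Geometry.Lorentzian

namespace Kerr

/-- The compact part `{‖y‖ ≤ ρ} ∩ {r(0, y) ≥ r₁}` of a closed slice region. [folklore] -/
theorem isCompact_closedBall_inter_radius_ge (a ρ r₁ : ℝ) :
    IsCompact (closedBall (0 : E3) ρ ∩ {y : E3 | r₁ ≤ radius a (E4.ofTimeSpace 0 y)}) :=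
  (isCompact_closedBall (0 : E3) ρ).inter_right
    (isClosed_le continuous_const ((continuous_radius a).comp (E4.continuous_ofTimeSpace 0)))

/-- **Boundedness of the leaf Hessian on the compact part of the leaf, from the Cauchy problem.**
Assume `KerrSchild.waveCauchyProblem`. For `|a| < M`, `R₁ > r₊`, an admissible `ψ`, `τ ≥ 0` and a
radius `ρ` there is `C` with `‖D²Ψ_τ(y)‖ ≤ C` for all `y ∈ S = {r(0,·) > r₊}` with `‖y‖ ≤ ρ`
(`Ψ_τ = leafFun … ψ τ` along `Σ̃_τ(h♯_{R₁})`). Proof: `ψ` agrees on `{t* ≥ 0}` with a smooth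
solution `Ψ̃` on the horizon-penetrating chart `{r > r₊/2}`
(`IsAdmissibleKerrWave.exists_horizonRegular_extension`; DRSR arXiv:1402.7034, §4.1); the leaf
function agrees near each point of `S` with `Ψ̃ ∘ (y ↦ (τ + h♯_{R₁}(y), y))`, smooth on the open
set `{r(0,·) > r₊/2}`, whose second differential is continuous there, hence bounded on the
compact `{‖y‖ ≤ ρ} ∩ {r(0,·) ≥ r₊}`. [cite: DafermosRodnianskiShlapentokhrothman2014, §4.1; BarGinouxPfaffle2007, Thm. 3.2.11] -/
theorem leafFun_fderiv_fderiv_bounded_of_waveCauchyProblem (hC : KerrSchild.waveCauchyProblem)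
    [Facts] [SliceFacts] {M a : ℝ} (hMa : IsSubextremal M a) {R₁ : ℝ} (hR₁ : rPlus M a < R₁)
    {ψ : region a (rPlus M a) → ℝ} (hψ : Literature.Geometry.Lorentzian.IsAdmissibleKerrWave M a ψ)
    {τ : ℝ} (hτ : 0 ≤ τ) (ρ : ℝ) :
    ∃ C : ℝ, ∀ y ∈ (slice a (rPlus M a) : Set E3), ‖y‖ ≤ ρ →
      ‖fderiv ℝ (fderiv ℝ (leafFun M a (scriHeight M a R₁) ψ τ)) y‖ ≤ C := by
  have hrp : 0 < rPlus M a := hMa.rPlus_pos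
  set r₀ : ℝ := rPlus M a / 2 with hr₀def
  have hr₀ : 0 < r₀ := by rw [hr₀def]; positivity
  have hr₀' : r₀ ≤ rPlus M a := by rw [hr₀def]; linarith
  -- the horizon-regular extension
  obtain ⟨Ψ, hΨs, -, -, hagree⟩ :=
    IsAdmissibleKerrWave.exists_horizonRegular_extension hC hMa hψ hr₀ hr₀'
  set h : E3 → ℝ := scriHeight M a R₁ with hh
  set G : E3 → ℝ := fun y ↦ Function.extend Subtype.val Ψ 0 (leafPoint h τ y) with hG
  set S₀ : Set E3 := (slice a r₀ : Set E3) with hS₀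
  have hS₀o : IsOpen S₀ := (slice a r₀).isOpen
  -- smoothness of `G` on `S₀`
  have hleaf : ContDiff ℝ ∞ (leafPoint h τ) := by
    have heq : leafPoint h τ = fun y ↦ (τ + h y) • E4.basisVector 0 + E4.ofTimeSpace 0 y :=
      funext (leafPoint_eq_smul_add _ τ)
    rw [heq]
    exact ((contDiff_const.add (contDiff_scriHeight hMa hR₁)).smul contDiff_const).add
      (E4.contDiff_ofTimeSpace 0)
  have hGon : ContDiffOn ℝ ∞ G S₀ := by
    intro y hy
    have hmem : leafPoint h τ y ∈ region a r₀ := ofTimeSpace_mem_region_iff.2 hy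
    exact ((contDiffAt_extend hΨs ⟨_, hmem⟩).comp y hleaf.contDiffAt).contDiffWithinAt
  -- the leaf function agrees with `G` near every point of `S`
  have hev : ∀ y ∈ (slice a (rPlus M a) : Set E3), leafFun M a h ψ τ =ᶠ[𝓝 y] G := by
    intro y hy
    filter_upwards [(slice a (rPlus M a)).isOpen.mem_nhds hy] with y' hy'
    have hmem : leafPoint h τ y' ∈ region a (rPlus M a) := ofTimeSpace_mem_region_iff.2 hy'
    have ht : 0 ≤ (leafPoint h τ y' : E4) 0 := by
      rw [leafPoint, E4.ofTimeSpace_apply_zero]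
      exact add_nonneg hτ (scriHeight_nonneg hMa hR₁ y')
    rw [leafFun_apply_of_mem h ψ τ hmem]
    refine (hagree ⟨leafPoint h τ y', hmem⟩ ht).trans ?_
    exact extend_rep Ψ ⟨leafPoint h τ y', region_mono a hr₀' hmem⟩
  have hD2 : ∀ y ∈ (slice a (rPlus M a) : Set E3),
      fderiv ℝ (fderiv ℝ (leafFun M a h ψ τ)) y = fderiv ℝ (fderiv ℝ G) y := fun y hy ↦
    ((hev y hy).fderiv (𝕜 := ℝ)).fderiv_eq
  -- the compact set and its inclusion in `S₀`
  set Kc : Set E3 := closedBall (0 : E3) ρ ∩ {y : E3 | rPlus M a ≤ radius a (E4.ofTimeSpace 0 y)}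
    with hKcdef
  have hKc : IsCompact Kc := isCompact_closedBall_inter_radius_ge a ρ (rPlus M a)
  have hKcS₀ : Kc ⊆ S₀ := by
    intro y hy
    have h1 : r₀ < radius a (E4.ofTimeSpace 0 y) := by
      have h2 : rPlus M a ≤ radius a (E4.ofTimeSpace 0 y) := hy.2
      linarith
    show y ∈ (slice a r₀ : Set E3)
    rw [SetLike.mem_coe, mem_slice]
    exact max_lt h1 (hr₀.trans h1)
  -- continuity of `D²G` on `Kc`, as the iterated derivative
  have hcont : ContinuousOn (iteratedFDeriv ℝ 2 G) Kc := by
    have h1 : ContinuousOn (iteratedFDerivWithin ℝ 2 G S₀) S₀ :=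
      hGon.continuousOn_iteratedFDerivWithin (by norm_cast) hS₀o.uniqueDiffOn
    exact (h1.mono hKcS₀).congr fun y hy ↦ (iteratedFDerivWithin_of_isOpen 2 hS₀o (hKcS₀ hy)).symm
  obtain ⟨C, hCb⟩ := hKc.exists_bound_of_continuousOn hcont
  refine ⟨C, fun y hy hyρ ↦ ?_⟩
  have hyK : y ∈ Kc := by
    refine ⟨mem_closedBall_zero_iff.2 hyρ, ?_⟩
    have h1 : max (rPlus M a) 0 < radius a (E4.ofTimeSpace 0 y) := mem_slice.1 hy
    exact ((le_max_left _ _).trans_lt h1).le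
  rw [hD2 y hy, ← norm_iteratedFDeriv_two_eq G y]
  exact hCb y hyK

/-- **DRSR Corollary 3.1 (31) from (D2), (D3), the local third-order decay (L3) and the Cauchy
problem.** `KerrSchild.waveCauchyProblem → (H′) → drsr_wave_derivative_decay_kerr`, where (H′) is
the hypothesis (H) of `drsr_wave_derivative_decay_kerr_of_localEnergy_decay`
(`KerrDerivativeDecayLocal.lean`) without the qualitative third clause of (D3′): for every
admissible `ψ` with ball data of radius `R₁ ≥ R₀`, (D2) `leafHessEnergy ψ τ ≤ C_δ τ^{-4+2δ}`,
(D3) `‖y‖|Ψ_τ| ≤ C₀ ∧ ‖y‖‖DΨ_τ‖ ≤ C₀` on `S` (both verbatim clauses of the (30)-chain's (D),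
`KerrPointwiseDecayHierarchy.lean`), (L3) `∫_{S∩{‖y‖<R₁}} ‖D³Ψ_τ‖² + ‖D²(TΨ)_τ‖² ≤ C_δ τ^{-4+2δ}`;
the missing clause is `Kerr.leafFun_fderiv_fderiv_bounded_of_waveCauchyProblem`. DRSR
arXiv:1402.7034, §3.3 Cor. 3.1 (31) with §4.1. [cite: DafermosRodnianskiShlapentokhrothman2014, Cor. 3.1 (31) and §4.1; Moschidis2016 Cor. 9.2] -/
theorem _root_.Literature.Geometry.Lorentzian.drsr_wave_derivative_decay_kerr_of_localEnergy_decay_of_waveCauchyProblem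
    (hC : KerrSchild.waveCauchyProblem)
    (hH' : ∀ [Facts] [SliceFacts] (M a : ℝ), IsSubextremal M a →
      ∃ R₀ : ℝ, rPlus M a < R₀ ∧ ∀ R₁ : ℝ, R₀ ≤ R₁ →
        ∀ ψ : region a (rPlus M a) → ℝ, Literature.Geometry.Lorentzian.IsAdmissibleKerrWave M a ψ →
          HasBallData M a R₁ ψ →
            -- (D2) second-order leaf energy, improved decay (whole leaf)
            (∀ δ : ℝ, 0 < δ → ∃ C : ℝ, ∀ τ : ℝ, 1 ≤ τ →
              leafHessEnergy M a (scriHeight M a R₁) ψ τ ≤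
                ENNReal.ofReal (C * τ ^ (-4 + 2 * δ))) ∧
            -- (D3) a priori decay along each leaf (radiation field)
            (∀ τ : ℝ, 1 ≤ τ → ∃ C₀ : ℝ, ∀ y ∈ (slice a (rPlus M a) : Set E3),
              ‖y‖ * |leafFun M a (scriHeight M a R₁) ψ τ y| ≤ C₀ ∧
                ‖y‖ * ‖fderiv ℝ (leafFun M a (scriHeight M a R₁) ψ τ) y‖ ≤ C₀) ∧
            -- (L3) local third-order improved decay
            (∀ δ : ℝ, 0 < δ → ∃ C : ℝ, ∀ τ : ℝ, 1 ≤ τ →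
              (∫⁻ y in (slice a (rPlus M a) : Set E3) ∩ ball (0 : E3) R₁, ENNReal.ofReal
                  (‖iteratedFDeriv ℝ 3 (leafFun M a (scriHeight M a R₁) ψ τ) y‖ ^ 2 +
                    ‖fderiv ℝ (fderiv ℝ (leafFun M a (scriHeight M a R₁) (timeDeriv ψ) τ)) y‖ ^ 2)) ≤
                ENNReal.ofReal (C * τ ^ (-4 + 2 * δ)))) :
    drsr_wave_derivative_decay_kerr := by
  refine drsr_wave_derivative_decay_kerr_of_localEnergy_decay ?_
  intro _ _ M a hMa
  obtain ⟨R₀, hR₀, hR⟩ := hH' M a hMa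
  refine ⟨R₀, hR₀, fun R₁ hR₁ ψ hψ hball ↦ ?_⟩
  obtain ⟨hD2, hD3, hL3⟩ := hR R₁ hR₁ ψ hψ hball
  refine ⟨hD2, fun τ hτ ↦ ?_, hL3⟩
  obtain ⟨C₀, hC₀⟩ := hD3 τ hτ
  obtain ⟨C₂, hC₂⟩ := leafFun_fderiv_fderiv_bounded_of_waveCauchyProblem hC hMa
    (hR₀.trans_le hR₁) hψ (zero_le_one.trans hτ) R₁
  exact ⟨max C₀ C₂, fun y hy ↦ ⟨(hC₀ y hy).1.trans (le_max_left _ _),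
    (hC₀ y hy).2.trans (le_max_left _ _), fun hyR ↦ (hC₂ y hy hyR).trans (le_max_right _ _)⟩⟩

end Kerr

end Literature.Geometry.Lorentzian

end
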